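import Literature.MathematicalPhysics.QuantumFieldTheory.Balaban1983to89.B6IndexCorrV1
import Literature.MathematicalPhysics.QuantumFieldTheory.Balaban1983to89.B6Geom246MultiLevelTorus

/-!
# `Balaban1983to89.B6MemberOfCubeV1` — T. Bałaban, *Propagators and renormalization transformations for lattice gauge theories. II*, Commun.
# Math. Phys. **96** (1984) 223–250 [Balaban1984PropagatorsII], p. 238–239, (2.89)–(2.91): THE MEMBER `(T_□, Λ′(□), w_□)` OF A CUBE `□`
# OF THE `L^{−j}`-SCALE, CONSTRUCTED FROM THE GLOBAL DATA `(𝔅, w)`, AND ITS RING HYPOTHESIS `hagree` FROM GEOMETRY ONLY — `Λ′(□)` by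
# (2.89) and `w_□` by pull-back are DEFINITIONS here, so the hypotheses `hΛ`, `hWj`, `hWj1` of `B6IndexCorrV1.hagree_domT` are PROVED, and
# the separation input `hfar` is DERIVED from (2.2) on the torus (`TDomains.sepT`) (item (d5-b)(i)–(ii) of the B6 fold owner's programme
# for the genuine k-level Proposition 2.6, B6-CLOSURE.md §5 item 12)

statement-level skeleton of published theorems with citation tags; proofs where landed; nothing here is a claim about the Yang–Mills mass gap

PDF held: `paper:balaban1984-cmp96-propagators-rt-ii` (journal page = PDF page + 222); p. 224 [PDF 2] ((2.2): *"dist(Ω_j^c, Ω_{j+1}) > RML^jη"*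
in the lineage's reading `TDomains.sepT`), p. 238–239 [PDF 16–17] (*"Let us take a cube □ connected with a L^{−j}-scale … We identify the
boundary of □̃³ and we get a torus which will be denoted by T_□ … We define B^j(Λ′) = □̃² ∩ B^{j+1}(Λ_{j+1}), (2.89)"*; (2.90) `G_□ = G(B^j(Λ′))`
with the two-scale `Δ_a` of the member).

CITATION HEADER (lean-in-tree rule) — WHAT IS REPRODUCED.  Phase-2 file of the `lit-balaban` typed skeleton (HOME `run/shared/lean/pub/lit-balaban/`),
unit `lit-balaban-r03` (B6 fold owner; r03 gen 19, literature-prover-lit-balaban-r03-g19-0), referee ref-4.  SKELETON rows **B6.Eq2.89** × **B6.Eq2.90**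
× **B6.Eq2.91** × **B6.Eq2.1-2.3 (2.2)** × **B6.Prop2.6** (cells; decls of record untouched).  IMPORTS BY NAME, restating nothing: `B6IndexCorrV1`
(**`hagree_domT`**, `lam…`), `B6AgreeQaQV1Chart` (`eSj`/`eBj`, `eSj_inj`, `iterBlockOf_eS`, `window_of_deep_block`, `deep_block_of_near`, `NearB`,
`wxG`/`wxG_of_lam`), `B6AgreeLapV1Chart` (`DeepS/DeepB`, `cB`, `eS_surj`, `deepS_mono`), `B6GlobalChartV1` (`PV`, `toBox`, `domT`,
`iterBlockOf_mem_domT_iff`), `B6Geom246MultiLevelTorus` (p21: **`dist_toT_toR`** — the torus sup-distance is a metric, `torusSupNorm_neg`),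
`B4TorusKernel.MultiPeriod` (`torusSupNorm`, `circAbs_le_abs`, `circAbs_add_mul`), `B6MultiLevelTorusOperator.TDomains` (**`sepT`** = (2.2)),
`B6Prop25TwoScaleCensus.TSIdx` (the member index: `m, K, j, Λ′, w` with the band `a₀(L^j)^{d+1} ≤ w ≤ a₁(L^j)^{d+1}`), `B6SectCTwoScaleV1.CIdx`.

THIS FILE (0 sorry; standard axioms; NO `def … : Prop`; six small definitions WITH BODIES: `bare`, `LamOf`, `wOf`, `memberOf`, `clampW`, `tOf`).
* §1 `eSj_surj` (the level chart is onto `T^{(k)}_□` from the window `k`-blocks); **`lam_chart_iff_of_image`** (if `Λ′` is the `e_{j+1}`-image of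
  the window `(j+1)`-blocks lying in a set `Om`, then `e_{j+1} Y ∈ Λ′ ↔ Y ∈ Om` on window blocks — injectivity of the chart).
* §2 **`torusSupNorm_lt_of_block_shift`** (adjacent `n`-blocks of `T_η`, wrapping allowed, are at torus sup-distance `< 2L^n`), `torusSupNorm_sub_le`
  (triangle inequality, from p21's `dist_toT_toR`), **`hfar_of_sepT`**: the separation input `hfar` of `hagree_domT` (no `Ω_n`-block adjacent to the
  `n`-block of a deep window site, `j + 2 ≤ n ≤ k`) from `TDomains.sepT (n − 1)`, given a site `x₁` of level `j` with the window (at depth `r`)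
  within torus distance `Δ` of it and `Δ + 2L^n ≤ R·M_h·L^n` (`= R·bigSide ℓ M_h (n−1)`).
* §3 the constructor: `bare` (size and scale only — names the charts), **`LamOf`** (`Λ′(□) := e_{j+1}{window (j+1)-blocks in Om}`), **`wOf`** (weights
  pulled back through the bond charts, default off the window image), **`memberOf`** (a `TSIdx`); `eBj_inj_window`; **`lam_memberOf`** (`hΛ` PROVED),
  **`w_memberOf_inl`**, **`w_memberOf_inr`** (the weight of the chart of a window bond is the prescribed one — PROVED by injectivity of `eBj`).
* §4 `clampW` (+ `clampW_mem`, `clampW_of_mem`), **`tOf`** (the member of a cube for the global data `(domT, w, c′)`: `Om := Ω_{j+1}`, weights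
  `clamp(w̃_j ∘ e⁻¹/(c′/L^j)²)`), **`hagree_tOf`**: `M·h_□ = (c′/L^j)²•(ε(Δ_□ + Q*a_□Q)ρ)·h_□` over `domT` for `t(□) = tOf …` and every `h_□`
  supported at margin `4L^{j+1}`, from: the two-level window `hlev`, the separation input `hfar`, and the band hypothesis `hband` (the global
  weights near `□`, divided by `(c′/L^j)²`, lie in `[a₀, a₁]·(L^j)^{d+1}`) — `hΛ`/`hWj`/`hWj1` discharged by construction.

HONEST SCOPE / DIVERGENCES. (1) `1 ≤ j`, `j + 1 ≤ k` as in `B6IndexCorrV1` (top scale and `Ω₁ = T_η` not treated). (2) The member's size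
`(m_t, K_t)` and the window corner `x₀` are free parameters here: that `□̃³` fits in the lower half-period sub-window with margin (F3 of the
programme, `B6FullWindowReachV1`) and that the window is two-level (`hlev`) are inputs of the assembly, from p21's cover `cubeSetT` — NOT proved
here. (3) `hband` is an hypothesis on the GLOBAL weights `w` of the V1 `Δ_a = deltaAE domT c′ w` (free in the V1 model); print's weights
`a(L^jη)^{−2}` on `Λ_j` satisfy it with `a₀ = a₁·L^{−(d+3)}`-type constants only scale by scale — the clamp keeps `t(□)` a legitimate `TSIdx` in all
cases and the agreement is claimed only under `hband`. (4) `hfar_of_sepT` asks for ONE site of level `j` near the window (print: *"□ connected with a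
L^{−j}-scale"*) and `R·M_h ≥ Δ/L^n + 2`; it is not asserted that every cube of p21's `cubeSetT` satisfies this (the assembly's job).
Value = typed skeleton: the third ring hypothesis of (2.91) for a constructed member, modulo cube geometry; NOT summit progress.
-/

noncomputable section

open scoped BigOperators
open Finset

namespace Literature.MathematicalPhysics.QuantumFieldTheory.Balaban1983to89.B6MemberOfCubeV1

open B6Prop25TwoScaleCensus (TSIdx)
open B6GlobalChartV1 (PV toBox domT iterBlockOf_mem_domT_iff)
open B6AgreeLapV1Chart
open B6AgreeQaQV1Chart
open B6IndexCorrV1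
open B5Eq118OneStroke (iterBlockOf iterBlock mem_iterBlock val_iterBlockOf iterBlockOf_zero iterBlockOf_succ)
open B6MultiLevelBoxOperator (N0)
open B6MultiLevelTorusOperator (TDomains)

variable {d ℓ : ℕ} {hd : 1 ≤ d + 1} {hL : Odd (ℓ + 1) ∧ 1 < ℓ + 1} {a₀ a₁ : ℝ} {m K : ℕ}
variable {t : TSIdx d (ℓ + 1) hd hL a₀ a₁} {x₀ : Fin (d + 1) → ℤ}

/-! ## §1  Every site of `T^{(k)}_□` is the chart of a window `k`-block; `Λ′(□)` as an image satisfies `hΛ` -/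

/-- **THE LEVEL CHART IS ONTO** `T^{(k)}_□` from the window `k`-blocks (every `k`-site of the member is the `k`-block of a fine site, every fine
site of `T_□` is charted from the window, and blocks go to blocks). [cite: Balaban1984PropagatorsII, p.238 (T_□ = □̃³), dictionary] -/
theorem eSj_surj {k : ℕ} (hk : k ≤ m + K) (hkt : k ≤ t.m + t.K) (hdiv : ∀ μ, ((((ℓ + 1) ^ k : ℕ) : ℤ)) ∣ x₀ μ)
    (hx₀ : ∀ μ, 0 ≤ x₀ μ) (hfit : ∀ μ, x₀ μ + (t.P.sitesPerDir 0 : ℕ) ≤ ((PV d ℓ m K hd hL).sitesPerDir 0 : ℕ)) (y' : Site t.P k) :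
    ∃ x : Site (PV d ℓ m K hd hL) 0, x ∈ DeepS t x₀ 0 ∧ eSj t x₀ k (iterBlockOf k x) = y' := by
  obtain ⟨x', hx'⟩ := iterBlock_nonempty (P := t.P) hkt y'
  rw [mem_iterBlock] at hx'
  obtain ⟨x, hx, hxx'⟩ := eS_surj hx₀ hfit x'
  exact ⟨x, hx, by rw [← iterBlockOf_eS hk hkt hdiv hx, hxx', hx']⟩

/-- **`Λ′(□)` AS THE CHART IMAGE OF `Ω_{j+1} ∩ window` SATISFIES `hΛ`** (print's (2.89) `B^j(Λ′) = □̃² ∩ B^{j+1}(Λ_{j+1})`): if the member's `Λ′`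
is the `e_{j+1}`-image of the set of window `(j+1)`-blocks lying in `Ω_{j+1}`, then for every window block `Y`: `e_{j+1} Y ∈ Λ′ ↔ Y ∈ Ω_{j+1}`
(injectivity of the level chart on window blocks). [cite: Balaban1984PropagatorsII, (2.89) p.239] -/
theorem lam_chart_iff_of_image (hjm : t.j + 1 ≤ m + K) (hdiv : ∀ μ, ((((ℓ + 1) ^ (t.j + 1) : ℕ) : ℤ)) ∣ x₀ μ)
    (Om S : Finset (Site (PV d ℓ m K hd hL) (t.j + 1)))
    (hS : ∀ Y, Y ∈ S ↔ (∀ x, iterBlockOf (t.j + 1) x = Y → x ∈ DeepS t x₀ 0) ∧ Y ∈ Om)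
    (hΛ' : t.Λ' = S.image (eSj t x₀ (t.j + 1))) (Y : Site (PV d ℓ m K hd hL) (t.j + 1))
    (hY : ∀ x, iterBlockOf (t.j + 1) x = Y → x ∈ DeepS t x₀ 0) :
    eSj t x₀ (t.j + 1) Y ∈ t.Λ' ↔ Y ∈ Om := by
  rw [hΛ', Finset.mem_image]
  constructor
  · rintro ⟨Y', hY'S, he⟩
    obtain ⟨hY'w, hY'Om⟩ := (hS Y').1 hY'S
    have := eSj_inj (window_of_deep_block hjm t.hj hdiv hY'w) (window_of_deep_block hjm t.hj hdiv hY) he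
    rwa [← this]
  · intro hOm
    exact ⟨Y, (hS Y).2 ⟨hY, hOm⟩, rfl⟩

/-! ## §2  The separation input `hfar` of `B6IndexCorrV1.hagree_domT` from (2.2) on the torus -/

section Far

open B4TorusKernel.MultiPeriod (torusSupNorm circAbs circAbs_le_abs circAbs_add_mul)
open B6Geom246MultiLevelTorus (toT dist_toT_toR torusSupNorm_neg)
open B6Geom246MultiLevelBox (toR)
open B6MultiLevelBoxOperator (bigSide)

variable {Mh k R : ℕ} {P' : Fin (d + 1) → ℕ}

/-- labels with equal quotients by `n` differ by less than `n`. [folklore] -/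
private theorem sub_lt_of_div_eq {a b n : ℕ} (hn : 0 < n) (h : a / n = b / n) : ((a : ℤ) - b) < n ∧ ((b : ℤ) - a) < n := by
  have h1 := Nat.lt_div_mul_add (a := a) hn
  have h2 := Nat.div_mul_le_self b n
  have h3 := Nat.lt_div_mul_add (a := b) hn
  have h4 := Nat.div_mul_le_self a n
  rw [h] at h1 h4
  constructor <;> omega

/-- consecutive quotients by `n`: the labels differ by a positive amount `< 2n`. [folklore] -/
private theorem sub_lt_of_div_succ {a b n : ℕ} (hn : 0 < n) (h : b / n = a / n + 1) : (0 : ℤ) < (b : ℤ) - a ∧ ((b : ℤ) - a) < 2 * n := by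
  have h1 := Nat.lt_div_mul_add (a := a) hn
  have h2 := Nat.div_mul_le_self b n
  have h3 := Nat.lt_div_mul_add (a := b) hn
  have h4 := Nat.div_mul_le_self a n
  rw [h, Nat.add_mul, one_mul] at h2 h3
  constructor <;> omega

/-- the periods of p21's torus are positive. [cite: Balaban1984PropagatorsII, p.238, dictionary] -/
theorem one_le_N0 (hN : ∀ μ, N0 ℓ Mh k P' μ = (PV d ℓ m K hd hL).sitesPerDir 0) : ∀ μ, 1 ≤ N0 ℓ Mh k P' μ := fun μ => by
  rw [hN μ]; exact Nat.pos_of_ne_zero ((PV d ℓ m K hd hL).sitesPerDir_ne_zero 0)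

/-- **ADJACENT `n`-BLOCKS ARE TORUS-CLOSE**: if the `n`-block of `x′` is the `μ`-successor (on the torus `T^{(n)}`, wrapping
allowed) of the `n`-block of `x`, then `|x − x′|_T < 2L^n` in p21's torus sup-distance of the labels. [cite: Balaban1984PropagatorsII, (2.2) p.224, dictionary] -/
theorem torusSupNorm_lt_of_block_shift (hN : ∀ μ, N0 ℓ Mh k P' μ = (PV d ℓ m K hd hL).sitesPerDir 0) {n : ℕ} (hn : n ≤ m + K)
    {x x' : Site (PV d ℓ m K hd hL) 0} {μ : Fin (d + 1)} (h : iterBlockOf n x' = (iterBlockOf n x).shift μ) :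
    torusSupNorm (N0 ℓ Mh k P') ((toBox hN x).1 - (toBox hN x').1) < 2 * (((ℓ + 1 : ℕ) : ℝ)) ^ n := by
  have hLn : 0 < (ℓ + 1) ^ n := by positivity
  simp only [torusSupNorm, Finset.sup'_lt_iff]
  intro ν _
  change ((circAbs (N0 ℓ Mh k P' ν) (((x ν).val : ℤ) - ((x' ν).val : ℤ)) : ℤ) : ℝ) < _
  have hv := val_iterBlockOf (P := PV d ℓ m K hd hL) n hn x ν
  have hv' := val_iterBlockOf (P := PV d ℓ m K hd hL) n hn x' ν
  change ((iterBlockOf n x) ν).val = (x ν).val / (ℓ + 1) ^ n at hv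
  change ((iterBlockOf n x') ν).val = (x' ν).val / (ℓ + 1) ^ n at hv'
  have hcast : (2 : ℝ) * (((ℓ + 1 : ℕ) : ℝ)) ^ n = ((((2 * (ℓ + 1) ^ n : ℕ) : ℤ)) : ℝ) := by push_cast; ring
  rw [hcast, Int.cast_lt]
  by_cases hνμ : ν = μ
  · subst hνμ
    have hsh : (iterBlockOf n x') ν = (iterBlockOf n x) ν + 1 := by rw [h]; simp [Site.shift]
    have hval : ((iterBlockOf n x') ν).val = (((iterBlockOf n x) ν).val + 1) % (PV d ℓ m K hd hL).sitesPerDir n := by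
      rw [hsh, ZMod.val_add, ZMod.val_one]
    have hlt : ((iterBlockOf n x) ν).val < (PV d ℓ m K hd hL).sitesPerDir n := ZMod.val_lt _
    by_cases hwrap : ((iterBlockOf n x) ν).val + 1 < (PV d ℓ m K hd hL).sitesPerDir n
    · rw [Nat.mod_eq_of_lt hwrap, hv, hv'] at hval
      obtain ⟨h1, h2⟩ := sub_lt_of_div_succ hLn hval
      refine lt_of_le_of_lt (circAbs_le_abs (one_le_N0 hN ν) _) ?_
      rw [abs_sub_comm, abs_of_pos h1]; exact_mod_cast h2
    · have heq : ((iterBlockOf n x) ν).val + 1 = (PV d ℓ m K hd hL).sitesPerDir n := by omega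
      rw [heq, Nat.mod_self, hv'] at hval
      have hN0 : N0 ℓ Mh k P' ν = (ℓ + 1) ^ n * (PV d ℓ m K hd hL).sitesPerDir n := by
        rw [hN ν]; exact sitesPerDir_zero_eq_mul (PV d ℓ m K hd hL) hn
      -- `a ≥ L^n (N_n − 1) = N₀ − L^n`, `a′ < L^n`
      have ha' : (x' ν).val < (ℓ + 1) ^ n := by
        have := Nat.lt_div_mul_add (a := (x' ν).val) hLn; rw [hval] at this; simpa using this
      have ha : (ℓ + 1) ^ n * ((PV d ℓ m K hd hL).sitesPerDir n - 1) ≤ (x ν).val := by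
        have h4 := Nat.div_mul_le_self ((x ν).val) ((ℓ + 1) ^ n)
        rw [← hv, show ((iterBlockOf n x) ν).val = (PV d ℓ m K hd hL).sitesPerDir n - 1 by omega, mul_comm] at h4
        exact h4
      have hax : (x ν).val < N0 ℓ Mh k P' ν := by rw [hN ν]; exact ZMod.val_lt _
      have key : circAbs (N0 ℓ Mh k P' ν) (((x ν).val : ℤ) - ((x' ν).val : ℤ)) =
          circAbs (N0 ℓ Mh k P' ν) ((((x ν).val : ℤ) - ((x' ν).val : ℤ) - (N0 ℓ Mh k P' ν : ℕ)) + (N0 ℓ Mh k P' ν : ℕ) * 1) := by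
        congr 1; ring
      rw [key, circAbs_add_mul]
      refine lt_of_le_of_lt (circAbs_le_abs (one_le_N0 hN ν) _) ?_
      have hNs : 1 ≤ (PV d ℓ m K hd hL).sitesPerDir n := Nat.pos_of_ne_zero ((PV d ℓ m K hd hL).sitesPerDir_ne_zero n)
      have hprod : (((ℓ + 1) ^ n * ((PV d ℓ m K hd hL).sitesPerDir n - 1) : ℕ) : ℤ) =
          ((ℓ + 1) ^ n : ℕ) * ((PV d ℓ m K hd hL).sitesPerDir n : ℕ) - ((ℓ + 1) ^ n : ℕ) := by
        rw [Nat.cast_mul, Nat.cast_sub hNs]; push_cast; ring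
      rw [hN0] at hax
      have ha2 : (((ℓ + 1) ^ n : ℕ) : ℤ) * ((PV d ℓ m K hd hL).sitesPerDir n : ℕ) - ((ℓ + 1) ^ n : ℕ) ≤ ((x ν).val : ℤ) := by
        rw [← hprod]; exact_mod_cast ha
      have hax' : ((x ν).val : ℤ) < (((ℓ + 1) ^ n : ℕ) : ℤ) * ((PV d ℓ m K hd hL).sitesPerDir n : ℕ) := by exact_mod_cast hax
      have ha'' : ((x' ν).val : ℤ) < (((ℓ + 1) ^ n : ℕ) : ℤ) := by exact_mod_cast ha'
      have h0 : (0 : ℤ) ≤ ((x' ν).val : ℤ) := by positivity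
      have hA : (0 : ℤ) < (((ℓ + 1) ^ n : ℕ) : ℤ) := by positivity
      rw [abs_lt, hN0, Nat.cast_mul, Nat.cast_mul, Nat.cast_ofNat]
      constructor <;> linarith
  · have hsh : (iterBlockOf n x') ν = (iterBlockOf n x) ν := by rw [h]; simp [Site.shift, Function.update_of_ne hνμ]
    have hval : (x' ν).val / (ℓ + 1) ^ n = (x ν).val / (ℓ + 1) ^ n := by rw [← hv, ← hv', hsh]
    obtain ⟨h1, h2⟩ := sub_lt_of_div_eq hLn hval
    refine lt_of_le_of_lt (circAbs_le_abs (one_le_N0 hN ν) _) ?_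
    have hA : (0 : ℤ) < (((ℓ + 1) ^ n : ℕ) : ℤ) := by positivity
    rw [abs_lt, Nat.cast_mul, Nat.cast_ofNat]; constructor <;> linarith

/-- `(y − e_μ) + e_μ = y`. [folklore] -/
private theorem munshift_shift {P : Params} {j : ℕ} (y : Site P j) (μ : Fin P.d) : (y.unshift μ).shift μ = y := by
  funext ν
  by_cases h : ν = μ
  · subst h; simp [Site.shift, Site.unshift]
  · simp [Site.shift, Site.unshift, Function.update_of_ne h]

/-- the torus sup-distance satisfies the triangle inequality (it is the metric of `Π_μ ℝ/N_μℤ` on labels, p21's `dist_toT_toR`).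
[cite: Balaban1984PropagatorsII, (2.54) p.233, dictionary] -/
theorem torusSupNorm_sub_le {N : Fin (d + 1) → ℕ} (hN1 : ∀ i, 1 ≤ N i) (a b c : Fin (d + 1) → ℤ) :
    torusSupNorm N (a - c) ≤ torusSupNorm N (a - b) + torusSupNorm N (b - c) := by
  rw [← dist_toT_toR hN1, ← dist_toT_toR hN1, ← dist_toT_toR hN1]
  exact dist_triangle _ _ _

/-- **THE SEPARATION INPUT `hfar` FROM (2.2) ON THE TORUS**: if the window of the member (at depth `r`) lies within torus
sup-distance `Δ` of a site `x₁` of level `j`, and `Δ + 2L^n ≤ R·M_h·L^n` for `j + 2 ≤ n ≤ k`, then no `n`-block adjacent (on `T^{(n)}`)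
to the `n`-block of a deep window site lies in `Ω_n`: such a block would contain a site of level `≥ n` within `Δ + 2L^n` of `x₁`, against
`dist_T(Ω^c_{n−1}, Ω_n) > R·M_h·L^n` ((2.2), `TDomains.sepT (n − 1)`). [cite: Balaban1984PropagatorsII, (2.2) p.224, p.238 («□ connected with a L^{−j}-scale»)] -/
theorem hfar_of_sepT (hN : ∀ μ, N0 ℓ Mh k P' μ = (PV d ℓ m K hd hL).sitesPerDir 0) (D : TDomains d ℓ Mh k P' R) (hk : k ≤ m + K)
    {r : ℕ} {Δ : ℝ} (x₁ : Site (PV d ℓ m K hd hL) 0) (hx₁ : D.lev (toBox hN x₁).1 = t.j)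
    (hΔ : ∀ x, x ∈ DeepS t x₀ r → torusSupNorm (N0 ℓ Mh k P') ((toBox hN x₁).1 - (toBox hN x).1) ≤ Δ)
    (hR : ∀ n, t.j + 2 ≤ n → n ≤ k → Δ + 2 * (((ℓ + 1 : ℕ) : ℝ)) ^ n ≤ ((R * bigSide ℓ Mh (n - 1) : ℕ) : ℝ)) :
    ∀ n, t.j + 2 ≤ n → n ≤ k → ∀ x : Site (PV d ℓ m K hd hL) 0, x ∈ DeepS t x₀ r → ∀ μ,
      (iterBlockOf n x).shift μ ∉ (domT hN D hk).Om n ∧ (iterBlockOf n x).unshift μ ∉ (domT hN D hk).Om n := by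
  intro n hn hnk x hx μ
  have hnm : n ≤ m + K := le_trans hnk hk
  have hN1 := one_le_N0 hN
  -- the common contradiction: a site `x'` of level `≥ n` torus-close to `x`
  have main : ∀ x' : Site (PV d ℓ m K hd hL) 0, n ≤ D.lev (toBox hN x').1 →
      ¬ torusSupNorm (N0 ℓ Mh k P') ((toBox hN x).1 - (toBox hN x').1) < 2 * (((ℓ + 1 : ℕ) : ℝ)) ^ n := by
    intro x' hlev hclose
    have hsep := D.sepT (n - 1) (toBox hN x₁).1 (toBox hN x₁).2 (toBox hN x').1 (toBox hN x').2 (by omega) (by omega)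
    have htri := torusSupNorm_sub_le hN1 (toBox hN x₁).1 (toBox hN x).1 (toBox hN x').1
    have := hR n hn hnk
    linarith [hΔ x hx]
  have get : ∀ Y : Site (PV d ℓ m K hd hL) n, Y ∈ (domT hN D hk).Om n →
      ∃ x' : Site (PV d ℓ m K hd hL) 0, iterBlockOf n x' = Y ∧ n ≤ D.lev (toBox hN x').1 := by
    intro Y hY
    obtain ⟨x', hx'⟩ := iterBlock_nonempty (P := PV d ℓ m K hd hL) hnm Y
    rw [mem_iterBlock] at hx'
    refine ⟨x', hx', ?_⟩
    have := (iterBlockOf_mem_domT_iff hN D hk (by omega) hnk x').1 (by rw [hx']; exact hY)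
    exact this
  constructor
  · intro hY
    obtain ⟨x', hx', hlev⟩ := get _ hY
    exact main x' hlev (torusSupNorm_lt_of_block_shift hN hnm hx')
  · intro hY
    obtain ⟨x', hx', hlev⟩ := get _ hY
    have h' : iterBlockOf n x = (iterBlockOf n x').shift μ := by rw [hx', munshift_shift]
    have hclose := torusSupNorm_lt_of_block_shift hN hnm h'
    rw [show (toBox hN x').1 - (toBox hN x).1 = -((toBox hN x).1 - (toBox hN x').1) by abel, torusSupNorm_neg hN1] at hclose
    exact main x' hlev hclose

end Far

/-! ## §3  THE MEMBER OF A CUBE: `Λ′(□)` and `w_□` BY CONSTRUCTION; `hΛ` and the weight correspondence PROVED -/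

section Construct

open B6SectCTwoScaleV1 (CIdx)

/-- the level-`k` bond chart is injective on window bonds. [cite: Balaban1984PropagatorsII, p.238, dictionary] -/
theorem eBj_inj_window {k : ℕ} (hk : k ≤ m + K) (hkt : k ≤ t.m + t.K) (hdiv : ∀ μ, ((((ℓ + 1) ^ k : ℕ) : ℤ)) ∣ x₀ μ)
    {β β₂ : PBond (PV d ℓ m K hd hL) k} (h1 : ∀ x, iterBlockOf k x = β.src → x ∈ DeepS t x₀ 0)
    (h2 : ∀ x, iterBlockOf k x = β₂.src → x ∈ DeepS t x₀ 0) (h : eBj t x₀ k β = eBj t x₀ k β₂) : β = β₂ := by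
  obtain ⟨s₁, μ₁⟩ := β
  obtain ⟨s₂, μ₂⟩ := β₂
  simp only [eBj, PBond.mk.injEq] at h
  obtain ⟨hs, hμ⟩ := h
  obtain rfl : s₁ = s₂ := eSj_inj (y := s₁) (y' := s₂) (window_of_deep_block hk hkt hdiv h1) (window_of_deep_block hk hkt hdiv h2) hs
  rw [hμ]

variable (d ℓ hd hL) in
/-- the BARE member of size `(m_t, K_t)` and scale `j` (empty `Λ′`, constant weights): only its torus parameters are used — to name the
charts `e_k` and the window before `Λ′(□)` and `w_□` are constructed. [cite: Balaban1984PropagatorsII, p.238, dictionary] -/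
def bare (mt Kt j : ℕ) (hj : j + 1 ≤ mt + Kt) (ha : a₀ ≤ a₁) : TSIdx d (ℓ + 1) hd hL a₀ a₁ where
  m := mt
  K := Kt
  j := j
  hj := hj
  Λ' := ∅
  w := fun _ => a₀ * ((((ℓ + 1 : ℕ) : ℝ)) ^ j) ^ (d + 1)
  hw0 := fun _ => le_rfl
  hw1 := fun _ => mul_le_mul_of_nonneg_right ha (by positivity)

open Classical in
/-- **`Λ′(□)`** — print's (2.89) `B^j(Λ′) = □̃² ∩ B^{j+1}(Λ_{j+1})` on the member torus: the `e_{j+1}`-image of the window `(j+1)`-blocks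
lying in `Ω_{j+1}` (given as a finite set `Om` of global `(j+1)`-sites). [cite: Balaban1984PropagatorsII, (2.89) p.239] -/
def LamOf (t₀ : TSIdx d (ℓ + 1) hd hL a₀ a₁) (x₀ : Fin (d + 1) → ℤ) (Om : Finset (Site (PV d ℓ m K hd hL) (t₀.j + 1))) :
    Finset (Site t₀.P (t₀.j + 1)) :=
  ((Finset.univ.filter fun Y : Site (PV d ℓ m K hd hL) (t₀.j + 1) =>
      (∀ x, iterBlockOf (t₀.j + 1) x = Y → x ∈ DeepS t₀ x₀ 0) ∧ Y ∈ Om)).image (eSj t₀ x₀ (t₀.j + 1))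

open Classical in
/-- **`w_□`** — the member's weights pulled back through the bond charts: a `Λ^c`-bond (resp. `Λ′`-bond) of the member which is the chart
of a window `j`-bond `β` (resp. `(j+1)`-bond `η`) gets `W β` (resp. `W₁ η`), any other the default. [cite: Balaban1984PropagatorsII, (2.90) p.239 («Δ_a» of the member), dictionary] -/
def wOf (t₀ : TSIdx d (ℓ + 1) hd hL a₀ a₁) (x₀ : Fin (d + 1) → ℤ) (Λ₁ : Finset (Site t₀.P (t₀.j + 1)))
    (W : PBond (PV d ℓ m K hd hL) t₀.j → ℝ) (W₁ : PBond (PV d ℓ m K hd hL) (t₀.j + 1) → ℝ) (dflt : ℝ) :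
    CIdx t₀.j Λ₁ → ℝ
  | Sum.inl β' => if h : ∃ β : PBond (PV d ℓ m K hd hL) t₀.j,
        (∀ x, iterBlockOf t₀.j x = β.src → x ∈ DeepS t₀ x₀ 0) ∧ eBj t₀ x₀ t₀.j β = β'.1 then W (Classical.choose h) else dflt
  | Sum.inr η' => if h : ∃ η : PBond (PV d ℓ m K hd hL) (t₀.j + 1),
        (∀ x, iterBlockOf (t₀.j + 1) x = η.src → x ∈ DeepS t₀ x₀ 0) ∧ eBj t₀ x₀ (t₀.j + 1) η = η'.1 then W₁ (Classical.choose h) else dflt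

/-- **THE MEMBER `t(□)` OF A CUBE**: size `(m_t, K_t)`, scale `j`, `Λ′(□) = e_{j+1}(Ω_{j+1} ∩ window)`, weights pulled back from `W`, `W₁`
(in the band `[a₀, a₁]·(L^j)^{d+1}`). [cite: Balaban1984PropagatorsII, (2.89)–(2.90) p.239] -/
def memberOf (mt Kt j : ℕ) (hj : j + 1 ≤ mt + Kt) (ha : a₀ ≤ a₁) (x₀ : Fin (d + 1) → ℤ)
    (Om : Finset (Site (PV d ℓ m K hd hL) (j + 1)))
    (W : PBond (PV d ℓ m K hd hL) j → ℝ) (W₁ : PBond (PV d ℓ m K hd hL) (j + 1) → ℝ)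
    (hW0 : ∀ β, a₀ * ((((ℓ + 1 : ℕ) : ℝ)) ^ j) ^ (d + 1) ≤ W β) (hW1 : ∀ β, W β ≤ a₁ * ((((ℓ + 1 : ℕ) : ℝ)) ^ j) ^ (d + 1))
    (hW₁0 : ∀ η, a₀ * ((((ℓ + 1 : ℕ) : ℝ)) ^ j) ^ (d + 1) ≤ W₁ η) (hW₁1 : ∀ η, W₁ η ≤ a₁ * ((((ℓ + 1 : ℕ) : ℝ)) ^ j) ^ (d + 1)) :
    TSIdx d (ℓ + 1) hd hL a₀ a₁ where
  m := mt
  K := Kt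
  j := j
  hj := hj
  Λ' := LamOf (bare d ℓ hd hL mt Kt j hj ha) x₀ Om
  w := wOf (bare d ℓ hd hL mt Kt j hj ha) x₀ (LamOf (bare d ℓ hd hL mt Kt j hj ha) x₀ Om) W W₁
    (a₀ * ((((ℓ + 1 : ℕ) : ℝ)) ^ j) ^ (d + 1))
  hw0 := by
    rintro (β' | η') <;> simp only [wOf] <;> split
    · exact hW0 _
    · exact le_rfl
    · exact hW₁0 _
    · exact le_rfl
  hw1 := by
    have hab : a₀ * ((((ℓ + 1 : ℕ) : ℝ)) ^ j) ^ (d + 1) ≤ a₁ * ((((ℓ + 1 : ℕ) : ℝ)) ^ j) ^ (d + 1) :=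
      mul_le_mul_of_nonneg_right ha (by positivity)
    rintro (β' | η') <;> simp only [wOf] <;> split
    · exact hW1 _
    · exact hab
    · exact hW₁1 _
    · exact hab

variable {mt Kt j : ℕ} {hj : j + 1 ≤ mt + Kt} {ha : a₀ ≤ a₁}
  {Om : Finset (Site (PV d ℓ m K hd hL) (j + 1))}
  {W : PBond (PV d ℓ m K hd hL) j → ℝ} {W₁ : PBond (PV d ℓ m K hd hL) (j + 1) → ℝ}
  {hW0 : ∀ β, a₀ * ((((ℓ + 1 : ℕ) : ℝ)) ^ j) ^ (d + 1) ≤ W β} {hW1 : ∀ β, W β ≤ a₁ * ((((ℓ + 1 : ℕ) : ℝ)) ^ j) ^ (d + 1)}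
  {hW₁0 : ∀ η, a₀ * ((((ℓ + 1 : ℕ) : ℝ)) ^ j) ^ (d + 1) ≤ W₁ η} {hW₁1 : ∀ η, W₁ η ≤ a₁ * ((((ℓ + 1 : ℕ) : ℝ)) ^ j) ^ (d + 1)}

/-- the scale of the member of a cube. [cite: Balaban1984PropagatorsII, p.238, dictionary] -/
@[simp] theorem memberOf_j : (memberOf mt Kt j hj ha x₀ Om W W₁ hW0 hW1 hW₁0 hW₁1).j = j := rfl

/-- the size of the member of a cube. [cite: Balaban1984PropagatorsII, p.238, dictionary] -/
theorem memberOf_mK : (memberOf mt Kt j hj ha x₀ Om W W₁ hW0 hW1 hW₁0 hW₁1).m = mt ∧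
    (memberOf mt Kt j hj ha x₀ Om W W₁ hW0 hW1 hW₁0 hW₁1).K = Kt := ⟨rfl, rfl⟩

/-- **`hΛ` HOLDS FOR THE CONSTRUCTED MEMBER**: on window `(j+1)`-blocks, `e_{j+1} Y ∈ Λ′(□) ↔ Y ∈ Ω_{j+1}`.
[cite: Balaban1984PropagatorsII, (2.89) p.239] -/
theorem lam_memberOf (hjm : j + 1 ≤ m + K) (hdiv : ∀ μ, ((((ℓ + 1) ^ (j + 1) : ℕ) : ℤ)) ∣ x₀ μ)
    (Y : Site (PV d ℓ m K hd hL) (j + 1))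
    (hY : ∀ x, iterBlockOf (j + 1) x = Y → x ∈ DeepS (memberOf mt Kt j hj ha x₀ Om W W₁ hW0 hW1 hW₁0 hW₁1) x₀ 0) :
    eSj (memberOf mt Kt j hj ha x₀ Om W W₁ hW0 hW1 hW₁0 hW₁1) x₀ (j + 1) Y ∈
        (memberOf mt Kt j hj ha x₀ Om W W₁ hW0 hW1 hW₁0 hW₁1).Λ' ↔ Y ∈ Om := by
  classical
  exact lam_chart_iff_of_image (t := memberOf mt Kt j hj ha x₀ Om W W₁ hW0 hW1 hW₁0 hW₁1) hjm hdiv Om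
    (Finset.univ.filter fun Y : Site (PV d ℓ m K hd hL) (j + 1) =>
      (∀ x, iterBlockOf (j + 1) x = Y → x ∈ DeepS (memberOf mt Kt j hj ha x₀ Om W W₁ hW0 hW1 hW₁0 hW₁1) x₀ 0) ∧ Y ∈ Om)
    (fun Y => by rw [Finset.mem_filter]; exact ⟨fun h => h.2, fun h => ⟨Finset.mem_univ _, h⟩⟩) rfl Y hY

/-- **THE WEIGHT CORRESPONDENCE ON `Λ^c`-BONDS HOLDS FOR THE CONSTRUCTED MEMBER**: the weight of the chart of a window `j`-bond `β` is `W β`.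
[cite: Balaban1984PropagatorsII, (2.90) p.239, dictionary] -/
theorem w_memberOf_inl (hjm : j ≤ m + K) (hdiv : ∀ μ, ((((ℓ + 1) ^ j : ℕ) : ℤ)) ∣ x₀ μ) (β : PBond (PV d ℓ m K hd hL) j)
    (hβ : ∀ x, iterBlockOf j x = β.src → x ∈ DeepS (memberOf mt Kt j hj ha x₀ Om W W₁ hW0 hW1 hW₁0 hW₁1) x₀ 0)
    (hβ' : blockOf (eBj (memberOf mt Kt j hj ha x₀ Om W W₁ hW0 hW1 hW₁0 hW₁1) x₀ j β).src ∉
        (memberOf mt Kt j hj ha x₀ Om W W₁ hW0 hW1 hW₁0 hW₁1).Λ' ∧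
      blockOf (eBj (memberOf mt Kt j hj ha x₀ Om W W₁ hW0 hW1 hW₁0 hW₁1) x₀ j β).tgt ∉
        (memberOf mt Kt j hj ha x₀ Om W W₁ hW0 hW1 hW₁0 hW₁1).Λ') :
    (memberOf mt Kt j hj ha x₀ Om W W₁ hW0 hW1 hW₁0 hW₁1).w
        (Sum.inl ⟨eBj (memberOf mt Kt j hj ha x₀ Om W W₁ hW0 hW1 hW₁0 hW₁1) x₀ j β, hβ'⟩) = W β := by
  classical
  show wOf (bare d ℓ hd hL mt Kt j hj ha) x₀ _ W W₁ _
      (Sum.inl ⟨eBj (memberOf mt Kt j hj ha x₀ Om W W₁ hW0 hW1 hW₁0 hW₁1) x₀ j β, hβ'⟩) = W β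
  simp only [wOf]
  split
  · rename_i h
    obtain ⟨h1, h2⟩ := Classical.choose_spec h
    rw [eBj_inj_window (t := memberOf mt Kt j hj ha x₀ Om W W₁ hW0 hW1 hW₁0 hW₁1) hjm (le_trans (Nat.le_succ j) hj) hdiv h1 hβ h2]
  · rename_i h
    exact absurd ⟨β, hβ, rfl⟩ h

/-- **THE WEIGHT CORRESPONDENCE ON `Λ′`-BONDS HOLDS FOR THE CONSTRUCTED MEMBER**: the weight of the chart of a window `(j+1)`-bond `η` is
`W₁ η`. [cite: Balaban1984PropagatorsII, (2.90) p.239, dictionary] -/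
theorem w_memberOf_inr (hjm : j + 1 ≤ m + K) (hdiv : ∀ μ, ((((ℓ + 1) ^ (j + 1) : ℕ) : ℤ)) ∣ x₀ μ) (η : PBond (PV d ℓ m K hd hL) (j + 1))
    (hη : ∀ x, iterBlockOf (j + 1) x = η.src → x ∈ DeepS (memberOf mt Kt j hj ha x₀ Om W W₁ hW0 hW1 hW₁0 hW₁1) x₀ 0)
    (hη' : (eBj (memberOf mt Kt j hj ha x₀ Om W W₁ hW0 hW1 hW₁0 hW₁1) x₀ (j + 1) η).src ∈
        (memberOf mt Kt j hj ha x₀ Om W W₁ hW0 hW1 hW₁0 hW₁1).Λ' ∨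
      (eBj (memberOf mt Kt j hj ha x₀ Om W W₁ hW0 hW1 hW₁0 hW₁1) x₀ (j + 1) η).tgt ∈
        (memberOf mt Kt j hj ha x₀ Om W W₁ hW0 hW1 hW₁0 hW₁1).Λ') :
    (memberOf mt Kt j hj ha x₀ Om W W₁ hW0 hW1 hW₁0 hW₁1).w
        (Sum.inr ⟨eBj (memberOf mt Kt j hj ha x₀ Om W W₁ hW0 hW1 hW₁0 hW₁1) x₀ (j + 1) η, hη'⟩) = W₁ η := by
  classical
  show wOf (bare d ℓ hd hL mt Kt j hj ha) x₀ _ W W₁ _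
      (Sum.inr ⟨eBj (memberOf mt Kt j hj ha x₀ Om W W₁ hW0 hW1 hW₁0 hW₁1) x₀ (j + 1) η, hη'⟩) = W₁ η
  simp only [wOf]
  split
  · rename_i h
    obtain ⟨h1, h2⟩ := Classical.choose_spec h
    rw [eBj_inj_window (t := memberOf mt Kt j hj ha x₀ Om W W₁ hW0 hW1 hW₁0 hW₁1) hjm hj hdiv h1 hη h2]
  · rename_i h
    exact absurd ⟨η, hη, rfl⟩ h

end Construct

/-! ## §4  `hagree` FOR THE MEMBER OF A CUBE over `domT`: `hΛ` and the weights DISCHARGED BY CONSTRUCTION -/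

section Agree

open B6SectAOperatorsV1 (dE dsE dcE dcsE QE aE QsE BondIdx)
open B6Prop26Gluing (mulOp)
open B6Prop26ReachTransplant (transplant chartBond)
open B6Ineq2133TwoScaleV1 (onFun)

variable {Mh k R : ℕ} {P' : Fin (d + 1) → ℕ}

/-- the clamp of a real to the weight band `[a₀, a₁]·(L^j)^{d+1}`. [cite: Balaban1984PropagatorsII, (2.90) p.239, dictionary] -/
def clampW (a₀ a₁ : ℝ) (X v : ℝ) : ℝ := max (a₀ * X) (min v (a₁ * X))

/-- the clamp lies in the band. [cite: Balaban1984PropagatorsII, (2.90) p.239, dictionary] -/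
theorem clampW_mem {a₀ a₁ X : ℝ} (ha : a₀ ≤ a₁) (hX : 0 ≤ X) (v : ℝ) : a₀ * X ≤ clampW a₀ a₁ X v ∧ clampW a₀ a₁ X v ≤ a₁ * X :=
  ⟨le_max_left _ _, max_le (mul_le_mul_of_nonneg_right ha hX) (min_le_right _ _)⟩

/-- the clamp is the identity on the band. [cite: Balaban1984PropagatorsII, (2.90) p.239, dictionary] -/
theorem clampW_of_mem {a₀ a₁ X v : ℝ} (h0 : a₀ * X ≤ v) (h1 : v ≤ a₁ * X) : clampW a₀ a₁ X v = v := by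
  rw [clampW, min_eq_left h1, max_eq_right h0]

/-- **THE MEMBER OF A CUBE FOR THE GLOBAL DATA** `(𝔅 = domT, w, c′)`: size `(m_t, K_t)`, scale `j`, window corner `x₀`,
`Λ′(□) = e_{j+1}(Ω_{j+1} ∩ window)`, weights `w_□ = clamp(w ∘ e⁻¹/(c′/L^j)²)` on `Λ^c(□) ⊔ Λ′(□)`. [cite: Balaban1984PropagatorsII, (2.89)–(2.90) p.239] -/
def tOf (hN : ∀ μ, N0 ℓ Mh k P' μ = (PV d ℓ m K hd hL).sitesPerDir 0) (D : TDomains d ℓ Mh k P' R) (hk : k ≤ m + K)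
    (wG : BondIdx (domT hN D hk) → ℝ) (c' : ℝ) (mt Kt j : ℕ) (hj : j + 1 ≤ mt + Kt) (ha : a₀ ≤ a₁) (x₀ : Fin (d + 1) → ℤ) :
    TSIdx d (ℓ + 1) hd hL a₀ a₁ :=
  memberOf mt Kt j hj ha x₀ ((domT hN D hk).Om (j + 1))
    (fun β => clampW a₀ a₁ (((((ℓ + 1 : ℕ) : ℝ)) ^ j) ^ (d + 1)) (wxG (domT hN D hk) wG j β / (c' / (((ℓ + 1 : ℕ) : ℝ) ^ j)) ^ 2))
    (fun η => clampW a₀ a₁ (((((ℓ + 1 : ℕ) : ℝ)) ^ j) ^ (d + 1)) (wxG (domT hN D hk) wG (j + 1) η / (c' / (((ℓ + 1 : ℕ) : ℝ) ^ j)) ^ 2))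
    (fun _ => (clampW_mem ha (by positivity) _).1) (fun _ => (clampW_mem ha (by positivity) _).2)
    (fun _ => (clampW_mem ha (by positivity) _).1) (fun _ => (clampW_mem ha (by positivity) _).2)

/-- the scale of `t(□)`. [cite: Balaban1984PropagatorsII, p.238, dictionary] -/
@[simp] theorem tOf_j (hN : ∀ μ, N0 ℓ Mh k P' μ = (PV d ℓ m K hd hL).sitesPerDir 0) (D : TDomains d ℓ Mh k P' R) (hk : k ≤ m + K)
    (wG : BondIdx (domT hN D hk) → ℝ) (c' : ℝ) (mt Kt j : ℕ) (hj : j + 1 ≤ mt + Kt) (ha : a₀ ≤ a₁) (x₀ : Fin (d + 1) → ℤ) :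
    (tOf hN D hk wG c' mt Kt j hj ha x₀).j = j := rfl

/-- **`hagree` FOR THE MEMBER OF A CUBE, FROM GEOMETRY ONLY**: for `t(□) = tOf …` the ring hypothesis `hagree` of (2.91) —
`M·h_□ = (c′/L^j)²•(ε(Δ_□ + Q*a_□Q)ρ)·h_□`, `M = ∂*∂ + ∂∂* + Q*aQ` over `domT` — holds for every `h_□` supported at margin `4L^{j+1}`, given the
two-level window `hlev`, the separation input `hfar` (see `hfar_of_sepT`) and the weight band of the global weights near `□` (`hband`:
`w/(c′/L^j)² ∈ [a₀, a₁]·(L^j)^{d+1}` on the near `Λ_j`/`Λ_{j+1}` bonds); `Λ′(□)` and `w_□` are discharged BY CONSTRUCTION (`lam_memberOf`,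
`w_memberOf_inl/inr`). [cite: Balaban1984PropagatorsII, (2.89)–(2.91) p.239, (2.2) p.224] -/
theorem hagree_tOf (hN : ∀ μ, N0 ℓ Mh k P' μ = (PV d ℓ m K hd hL).sitesPerDir 0) (D : TDomains d ℓ Mh k P' R) (hk : k ≤ m + K)
    (wG : BondIdx (domT hN D hk) → ℝ) {c' : ℝ} (hc' : c' ≠ 0) (mt Kt j : ℕ) (hj : j + 1 ≤ mt + Kt) (ha : a₀ ≤ a₁)
    (hx₀ : ∀ μ, 0 ≤ x₀ μ) (hfit : ∀ μ, x₀ μ + ((bare d ℓ hd hL mt Kt j hj ha).P.sitesPerDir 0 : ℕ) ≤ ((PV d ℓ m K hd hL).sitesPerDir 0 : ℕ))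
    {r : ℕ} (hj1 : 1 ≤ j) (hjk : j + 1 ≤ k) (hdiv : ∀ μ, ((((ℓ + 1) ^ (j + 1) : ℕ) : ℤ)) ∣ x₀ μ) (hr : 4 * (ℓ + 1) ^ (j + 1) ≤ r)
    (hlev : ∀ x : Site (PV d ℓ m K hd hL) 0, x ∈ DeepS (bare d ℓ hd hL mt Kt j hj ha) x₀ 0 →
      j ≤ D.lev (toBox hN x) ∧ D.lev (toBox hN x) ≤ j + 1)
    (hfar : ∀ n, j + 2 ≤ n → n ≤ k → ∀ x : Site (PV d ℓ m K hd hL) 0, x ∈ DeepS (bare d ℓ hd hL mt Kt j hj ha) x₀ r → ∀ μ,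
      (iterBlockOf n x).shift μ ∉ (domT hN D hk).Om n ∧ (iterBlockOf n x).unshift μ ∉ (domT hN D hk).Om n)
    (hband : ∀ i : BondIdx (domT hN D hk), ((i.1.1 : ℕ) = j ∨ (i.1.1 : ℕ) = j + 1) →
      NearB (bare d ℓ hd hL mt Kt j hj ha) x₀ r i.1.1 i.1.2 →
      a₀ * ((((ℓ + 1 : ℕ) : ℝ)) ^ j) ^ (d + 1) ≤ wG i / (c' / (((ℓ + 1 : ℕ) : ℝ) ^ j)) ^ 2 ∧
        wG i / (c' / (((ℓ + 1 : ℕ) : ℝ) ^ j)) ^ 2 ≤ a₁ * ((((ℓ + 1 : ℕ) : ℝ)) ^ j) ^ (d + 1))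
    (h : PBond (PV d ℓ m K hd hL) 0 → ℝ) (hh : ∀ b, h b ≠ 0 → b ∈ DeepB (bare d ℓ hd hL mt Kt j hj ha) x₀ r) :
    onFun (dcsE (P := PV d ℓ m K hd hL) c' ∘ₗ dcE c' + dE c' ∘ₗ dsE c' +
        QsE (domT hN D hk) ∘ₗ aE (domT hN D hk) wG ∘ₗ QE (domT hN D hk)) * mulOp h =
      (c' / (((ℓ + 1 : ℕ) : ℝ) ^ j)) ^ 2 •
        (transplant (cB (tOf hN D hk wG c' mt Kt j hj ha x₀) x₀ hx₀ hfit).W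
            (chartBond (tOf hN D hk wG c' mt Kt j hj ha x₀) posV PBond.dir x₀)
          (onFun ((tOf hN D hk wG c' mt Kt j hj ha x₀).D.lapV +
            LinearMap.adjoint (tOf hN D hk wG c' mt Kt j hj ha x₀).D.Q ∘ₗ (tOf hN D hk wG c' mt Kt j hj ha x₀).D.a ∘ₗ
              (tOf hN D hk wG c' mt Kt j hj ha x₀).D.Q)) * mulOp h) := by
  have hL1 : (0 : ℝ) < ((ℓ + 1 : ℕ) : ℝ) := by positivity
  have hs : (c' / (((ℓ + 1 : ℕ) : ℝ) ^ j)) ^ 2 ≠ 0 := by positivity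
  have hjm : j + 1 ≤ m + K := by omega
  have hdivj : ∀ μ, ((((ℓ + 1) ^ j : ℕ) : ℤ)) ∣ x₀ μ := fun μ =>
    dvd_trans (by exact_mod_cast pow_dvd_pow (ℓ + 1) (Nat.le_succ j)) (hdiv μ)
  have h2r : 0 + 2 * (ℓ + 1) ^ j ≤ r := by
    have : (ℓ + 1) ^ j ≤ (ℓ + 1) ^ (j + 1) := Nat.pow_le_pow_right (Nat.succ_pos ℓ) (Nat.le_succ j)
    omega
  have h2r1 : 0 + 2 * (ℓ + 1) ^ (j + 1) ≤ r := by omega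
  refine hagree_domT (t := tOf hN D hk wG c' mt Kt j hj ha x₀) hN D hk wG hc' hj1 hjk hdiv hr hlev
    (fun Y hY => lam_memberOf hjm hdiv Y hY) hfar ?_ ?_ h hh
  · intro hlt β hβ hβ' hnear
    obtain ⟨b₁, hb₁, hne⟩ := hnear
    have hβw := deep_block_of_near (t := tOf hN D hk wG c' mt Kt j hj ha x₀) (r := 0) (by omega) hx₀ (deepS_mono h2r hb₁) hne
    have hw := w_memberOf_inl (mt := mt) (Kt := Kt) (hj := hj) (ha := ha) (x₀ := x₀) (Om := (domT hN D hk).Om (j + 1))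
      (W := fun β => clampW a₀ a₁ (((((ℓ + 1 : ℕ) : ℝ)) ^ j) ^ (d + 1)) (wxG (domT hN D hk) wG j β / (c' / (((ℓ + 1 : ℕ) : ℝ) ^ j)) ^ 2))
      (W₁ := fun η => clampW a₀ a₁ (((((ℓ + 1 : ℕ) : ℝ)) ^ j) ^ (d + 1)) (wxG (domT hN D hk) wG (j + 1) η / (c' / (((ℓ + 1 : ℕ) : ℝ) ^ j)) ^ 2))
      (hW0 := fun _ => (clampW_mem ha (by positivity) _).1) (hW1 := fun _ => (clampW_mem ha (by positivity) _).2)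
      (hW₁0 := fun _ => (clampW_mem ha (by positivity) _).1) (hW₁1 := fun _ => (clampW_mem ha (by positivity) _).2)
      (by omega) hdivj β hβw hβ'
    change wG ⟨⟨⟨j, hlt⟩, β⟩, hβ⟩ = (c' / (((ℓ + 1 : ℕ) : ℝ) ^ j)) ^ 2 *
      (tOf hN D hk wG c' mt Kt j hj ha x₀).w (Sum.inl ⟨eBj (tOf hN D hk wG c' mt Kt j hj ha x₀) x₀ j β, hβ'⟩)
    have hw' : (tOf hN D hk wG c' mt Kt j hj ha x₀).w (Sum.inl ⟨eBj (tOf hN D hk wG c' mt Kt j hj ha x₀) x₀ j β, hβ'⟩) =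
        clampW a₀ a₁ (((((ℓ + 1 : ℕ) : ℝ)) ^ j) ^ (d + 1)) (wxG (domT hN D hk) wG j β / (c' / (((ℓ + 1 : ℕ) : ℝ) ^ j)) ^ 2) := hw
    rw [hw', wxG_of_lam (domT hN D hk) wG (n := j) hlt hβ]
    obtain ⟨h0, h1⟩ := hband ⟨⟨⟨j, hlt⟩, β⟩, hβ⟩ (Or.inl rfl) ⟨b₁, hb₁, hne⟩
    rw [clampW_of_mem h0 h1, mul_div_cancel₀ _ hs]
  · intro hlt η hη hη' hnear
    obtain ⟨b₁, hb₁, hne⟩ := hnear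
    have hηw := deep_block_of_near (t := tOf hN D hk wG c' mt Kt j hj ha x₀) (r := 0) hjm hx₀ (deepS_mono h2r1 hb₁) hne
    have hw := w_memberOf_inr (mt := mt) (Kt := Kt) (hj := hj) (ha := ha) (x₀ := x₀) (Om := (domT hN D hk).Om (j + 1))
      (W := fun β => clampW a₀ a₁ (((((ℓ + 1 : ℕ) : ℝ)) ^ j) ^ (d + 1)) (wxG (domT hN D hk) wG j β / (c' / (((ℓ + 1 : ℕ) : ℝ) ^ j)) ^ 2))
      (W₁ := fun η => clampW a₀ a₁ (((((ℓ + 1 : ℕ) : ℝ)) ^ j) ^ (d + 1)) (wxG (domT hN D hk) wG (j + 1) η / (c' / (((ℓ + 1 : ℕ) : ℝ) ^ j)) ^ 2))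
      (hW0 := fun _ => (clampW_mem ha (by positivity) _).1) (hW1 := fun _ => (clampW_mem ha (by positivity) _).2)
      (hW₁0 := fun _ => (clampW_mem ha (by positivity) _).1) (hW₁1 := fun _ => (clampW_mem ha (by positivity) _).2)
      hjm hdiv η hηw hη'
    change wG ⟨⟨⟨j + 1, hlt⟩, η⟩, hη⟩ = (c' / (((ℓ + 1 : ℕ) : ℝ) ^ j)) ^ 2 *
      (tOf hN D hk wG c' mt Kt j hj ha x₀).w (Sum.inr ⟨eBj (tOf hN D hk wG c' mt Kt j hj ha x₀) x₀ (j + 1) η, hη'⟩)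
    have hw' : (tOf hN D hk wG c' mt Kt j hj ha x₀).w (Sum.inr ⟨eBj (tOf hN D hk wG c' mt Kt j hj ha x₀) x₀ (j + 1) η, hη'⟩) =
        clampW a₀ a₁ (((((ℓ + 1 : ℕ) : ℝ)) ^ j) ^ (d + 1)) (wxG (domT hN D hk) wG (j + 1) η / (c' / (((ℓ + 1 : ℕ) : ℝ) ^ j)) ^ 2) := hw
    rw [hw', wxG_of_lam (domT hN D hk) wG (n := j + 1) hlt hη]
    obtain ⟨h0, h1⟩ := hband ⟨⟨⟨j + 1, hlt⟩, η⟩, hη⟩ (Or.inr rfl) ⟨b₁, hb₁, hne⟩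
    rw [clampW_of_mem h0 h1, mul_div_cancel₀ _ hs]

end Agree

end Literature.MathematicalPhysics.QuantumFieldTheory.Balaban1983to89.B6MemberOfCubeV1

end
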